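import Summits.QuantumFields.BalabanUV.Beta.GAN24.FineReadoutCauchyTail
import Summits.QuantumFields.BalabanUV.Beta.GAN24.FineReadoutCauchyFold

/-!
# `BalabanUV.Beta.GAN24.FineReadoutCauchyTailFold` — binder row G-an2-4 / (CONV-C), S-slot located remainder, road «S3», located leaf
# «(N1-Cauchy)»: PART K IN THE COORDINATES OF THE HOLDER'S FOLD — THE DIFFERENCE SYMBOL IS THE MATCHED COMPARISON PLUS AN `O(1/N)` TAIL

**G-an2-4 FORMALISATION SWARM, `b2b-balaban-gan24-formalise-leaf-01` (gen 11) — PART K of «(N1-Cauchy)», second module** (owner's typed spec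
`HOME/b2b-balaban-gan24-p1/N1-CAUCHY-SPEC.md` v1; holder leaf-17's division `N1-CAUCHY-DIVISION.md` v1, PARTS F/N/A/C/K/S).  NOT IN PRINT; OUR
PROOF ATTEMPT (of the road; THIS file is [folklore] bookkeeping over TREE theorems BY NAME: the holder's PART F `FineReadoutCauchyFrame.diffSym`
and PART N `FineReadoutCauchyFold.diffSym_eq_sum_fold` / `boxW`, leaf-17's `AliasNest` (`nest`, `unnestL`, `unnestM`, `sum_nest`), leaf-14's
`AliasReindex` (`lift`, `newLabels`), E3A3 `FibreDFTDictionary.boxData_inl_eq_sum` / `FineReadoutSum.norm_pw_repZ_le`, this seat's PART K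
`FineReadoutCauchyTail.sum_newLabels_norm_le` / `norm_ampA_le_pointWeight`, and at `d = 3` leaf-09's `FibreDetStripHolds.exists_strip`; no cited
fact, no wall binder, no `def`, no `def … : Prop`).  HONEST FRAMING (cell contract, verbatim): «discharging `BetaPertH` makes Bałaban's UV
stability UNCONDITIONAL — a real constructive-QFT result; it is NOT the continuum limit and NOT the Clay problem.»  HONEST DEPENDENCY (verbatim):
«continuum YM on T⁴ ⇐ BetaPertH ∧ nine spine estimates (0/9 proved); BetaPertH ⇐ (D1) ∧ (D4) ∧ CAP+tail; G-an2-4 gates asym, D1 and NE2/3/4.»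
Discharges NOTHING of (hS, hSall) / «E3Shape» / «E3SupRate»: «(N1-Cauchy)» stays OPEN until the MATCHED comparison (division PART A, with
PART C inside) is a tree theorem; NOT `BetaPertH`, NOT continuum, NOT Clay.

## What is here
The holder's fold writes the difference symbol of the cell-mean one-step comparison alias by alias at level `N`, each alias `m` carrying
its `Lc^{d+1}` sub-aliases `nest N′ N m t` (`N′ = N·Lc`, val-representative nesting).  EXACTLY ONE sub-alias is the MATCHED one — the lift
`AliasReindex.lift N′ m` by the symmetric representative (`t_i = 0` where `srep m i ≥ 0`, `t_i = Lc − 1` where `srep m i < 0`; §1) — and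
the others are precisely the NEW LABELS `AliasReindex.newLabels N N′`, whose total is `O(1/N)` by PART K (`GAN24/FineReadoutCauchyTail`).
* §1 (generic `D`; `N′ = N·Lc`) `unnestL_lift` (`unnestL N (lift N′ m) = m`), `nest_unnestM_lift` (`nest N′ N m (unnestM N Lc (lift N′ m)) = lift N′ m`),
  **`nest_not_mem_newLabels_iff`** (`nest N′ N m t ∉ newLabels N N′ ↔ t = unnestM N Lc (lift N′ m)`), **`sum_nest_eq_lift_add`**
  (`Σ_t G (nest m t) = G (lift N′ m) + Σ_{t : nest m t ∈ newLabels} G (nest m t)`), **`sum_sum_nest_mem_newLabels`**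
  (`Σ_m Σ_{t : nest m t ∈ newLabels} G (nest m t) = Σ_{m′ ∈ newLabels N N′} G m′`).
* §2 `norm_boxW_kFine_le`: `‖boxW Lc (k′_{m′})‖ ≤ Lc^{d+1}·e^{(d+1)η}` on `|Im p_i| ≤ η` (`Lc ≤ N′`).
* §3 (E3A currency: complex `p`, `|Re p_i| ≤ π`, `|Im p_i| ≤ η`, `0 ≤ η ≤ 1/4`, `(3D/2+2)η ≤ 1/2`; (U1)+A at the FINER side `N′`)
  **`sum_norm_foldTail_le`**: `Σ_m ‖(Lc^{d+1})⁻¹N′^{d+2}·(Σ_{t : nest m t new} boxW(k′)·Â′_{nest m t,κ})·e^{i k_m·ζ}‖ ≤ e^{2(d+1)η}·A·K_{d+1}·(2/N)·(r₀²C₀ + r₀³C₁)`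
  (`K_D = √12^D·√6·(1+8D)`, `C₀ = (3π)·3^D·aliasConst D 0`, `C₁ = (3π)²·3^D·aliasConst D (−1)`).
* §4 **`diffSym_eq_matched_add_tail`** (no hypothesis; amplitudes `ampA` of `FibreDFTDictionary` at both levels):
  `diffSym N N′ Lc κ l z p = Σ_m [(Lc^{d+1})⁻¹N′^{d+2}·boxW(k′_{lift m})·Â′_{lift m,κ} − N^{d+2}·Â_{mκ}]·e^{i k_m·ζ} + (the new-label tail)`, and
  **`norm_diffSym_le_matched_add`**: `‖diffSym … p‖ ≤ e^{(d+1)η}·Σ_m ‖(Lc^{d+1})⁻¹N′^{d+2}·boxW(k′_{lift m})·Â′_{lift m,κ} − N^{d+2}·Â_{mκ}‖ + e^{2(d+1)η}·A·K·(2/N)·(r₀²C₀ + r₀³C₁)`.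
* §5 (`d = 3`, every `Lc ≥ 1`, ONE strip for all levels) **`exists_norm_diffSym_le_matched_add`**: `∃ κ₁ > 0, C ≥ 0, ∀ n, ∀ p ∈ Strip 4 κ₁, ∀ κ l z,
  ‖diffSym (Lc^(n+1)) (Lc^(n+2)) Lc κ l z p‖ ≤ e^{4κ₁}·Σ_m ‖matched_m(p)‖ + C·(Lc⁻¹)^(n+1)` — so a bound `c_A·θ^n` on the matched sum over a
  punctured strip (PART A) IS the hypothesis of the holder's `FineReadoutCauchyOfPieces.exists_wH_cellMean_cauchy_of_punctured` with
  `θ′ = max θ Lc⁻¹`; the real zone `η = 0` is a case of §3–§4 for the real-zone assembly (leaf-16-g9 / leaf-13-g18 findings).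
0 sorry; axioms {propext, Classical.choice, Quot.sound}.  Unit `b2b-balaban-gan24-formalise-leaf-01` (gen 11), 2026-08-20.
-/

noncomputable section

open Complex Finset Matrix
open scoped BigOperators Real Matrix.Norms.L2Operator
open Literature.Probability.LatticeModels (Site TorusSite Torus.proj)
open Literature.MathematicalPhysics.QuantumFieldTheory.LatticeForm (repZ)
open Literature.MathematicalPhysics.QuantumFieldTheory.Balaban1983to89
open Literature.MathematicalPhysics.QuantumFieldTheory.Balaban1983to89.Beta
open Literature.MathematicalPhysics.QuantumFieldTheory.King1986 (aliasConst)
open B4Strip (Strip reVec)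
open BlochFibreMatrix (Idx stencil pieceMatrix)
open FibreInverseDecay (trigPolySymbol)
open AffineAveraging (box toSite)
open Summit.QuantumFields.BalabanUV.Beta.GAN24.FibreSymbols (pw)
open Summit.QuantumFields.BalabanUV.Beta.GAN24.FibreDFT (kFine)
open Summit.QuantumFields.BalabanUV.Beta.GAN24.FibreDFTDictionary (ampA boxData_inl_eq_sum)
open Summit.QuantumFields.BalabanUV.Beta.GAN24.AliasObjects (gs kAl)
open Summit.QuantumFields.BalabanUV.Beta.GAN24.AliasReindex (srep lift newLabels srep_lift lift_not_mem_newLabels intCast_srep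
  mem_newLabels_iff_not_mem_range)
open Summit.QuantumFields.BalabanUV.Beta.GAN24.AliasNest (nest unnestL unnestM sum_nest nest_unnest unnestL_nest unnestM_nest)
open Summit.QuantumFields.BalabanUV.Beta.GAN24.ArrowOperator (arrowMat)
open Summit.QuantumFields.BalabanUV.Beta.GAN24.ArrowScaling (scaledArrow radI radO radI_pos radO_pos)
open Summit.QuantumFields.BalabanUV.Beta.GAN24.StripLegApriori (radO_zero_le_two_pi)
open Summit.QuantumFields.BalabanUV.Beta.GAN24.StripAliasWeights (norm_cexp_offset_eq)
open Summit.QuantumFields.BalabanUV.Beta.GAN24.CombesThomasFibre (fibInv)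
open Summit.QuantumFields.BalabanUV.Beta.GAN24.AliasPointSum (pointWeight pointWeight_nonneg)
open Summit.QuantumFields.BalabanUV.Beta.GAN24.FineReadoutSum (norm_pw_repZ_le)
open Summit.QuantumFields.BalabanUV.Beta.GAN24.FibreDetStripHolds (exists_strip)
open Summit.QuantumFields.BalabanUV.Beta.GAN24.FineReadoutCauchyFrame (diffSym)
open Summit.QuantumFields.BalabanUV.Beta.GAN24.FineReadoutCauchyFold (boxW boxW_eq_prod diffSym_eq_sum_fold)
open Summit.QuantumFields.BalabanUV.Beta.GAN24.FineReadoutCauchyTail (norm_ampA_le_pointWeight sum_newLabels_norm_le)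

namespace Summit.QuantumFields.BalabanUV.Beta.GAN24.FineReadoutCauchyTailFold

/-! ## §1 The nested frame against the lift: which sub-alias is the matched one -/

section Dictionary

variable {D N N' Lc : ℕ} [NeZero N] [NeZero N'] [NeZero Lc]

omit [NeZero N] [NeZero Lc] in
/-- [folklore] **THE COARSE RESIDUE OF THE LIFT IS THE CLASS ITSELF**: `unnestL N (lift N′ m) = m` (`N′ = N·Lc`; the symmetric representative
reduced modulo `N` is the class). -/
theorem unnestL_lift (hN : N' = N * Lc) (m : TorusSite D N) : unnestL N (lift N' m) = m := by
  funext i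
  have hdvd : N ∣ N' := ⟨Lc, hN⟩
  unfold unnestL
  rw [ZMod.natCast_mod, ZMod.natCast_val, AliasReindex.lift_apply, ZMod.cast_intCast hdvd, intCast_srep]

/-- [folklore] **THE LIFT IS A SUB-ALIAS**: `nest N′ N m (unnestM N Lc (lift N′ m)) = lift N′ m` — the matched sub-alias of `m` is the one
whose fine index is the quotient of the lift's representative by `N` (`0` where `srep m i ≥ 0`, `Lc − 1` where `srep m i < 0`). -/
theorem nest_unnestM_lift (hN : N' = N * Lc) (m : TorusSite D N) : nest N' N m (unnestM N Lc (lift N' m)) = lift N' m := by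
  have h := nest_unnest hN (lift N' m)
  rwa [unnestL_lift hN] at h

/-- [folklore] **A SUB-ALIAS IS MATCHED IFF IT IS THE LIFT**: `nest N′ N m t ∉ newLabels N N′ ↔ t = unnestM N Lc (lift N′ m)`. -/
theorem nest_not_mem_newLabels_iff (hN : N' = N * Lc) (m : TorusSite D N) (t : TorusSite D Lc) :
    nest N' N m t ∉ (newLabels N N' : Finset (TorusSite D N')) ↔ t = unnestM N Lc (lift N' m) := by
  have hNN' : N ≤ N' := by
    rw [hN]; exact Nat.le_mul_of_pos_right _ (Nat.pos_of_ne_zero (NeZero.ne Lc))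
  rw [mem_newLabels_iff_not_mem_range hNN', not_not]
  constructor
  · rintro ⟨m₀, hm₀⟩
    have h1 : unnestL N (lift N' m₀) = unnestL N (nest N' N m t) := by rw [hm₀]
    rw [unnestL_lift (Lc := Lc) hN, unnestL_nest hN] at h1
    subst h1
    have h2 : unnestM N Lc (lift N' m₀) = unnestM N Lc (nest N' N m₀ t) := by rw [hm₀]
    rw [unnestM_nest hN] at h2
    exact h2.symm
  · rintro rfl
    exact ⟨m, (nest_unnestM_lift hN m).symm⟩

/-- [folklore] **THE SUB-ALIAS SUM SPLITS INTO THE MATCHED TERM AND THE NEW LABELS**: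
`Σ_t G (nest m t) = G (lift N′ m) + Σ_{t : nest m t ∈ newLabels N N′} G (nest m t)`. -/
theorem sum_nest_eq_lift_add {E : Type*} [AddCommMonoid E] (hN : N' = N * Lc) (m : TorusSite D N) (G : TorusSite D N' → E) :
    ∑ t : TorusSite D Lc, G (nest N' N m t) =
      G (lift N' m) + ∑ t ∈ (Finset.univ : Finset (TorusSite D Lc)).filter
        (fun t => nest N' N m t ∈ (newLabels N N' : Finset (TorusSite D N'))), G (nest N' N m t) := by
  classical
  rw [← Finset.sum_filter_add_sum_filter_not Finset.univ
    (fun t : TorusSite D Lc => nest N' N m t ∉ (newLabels N N' : Finset (TorusSite D N')))]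
  congr 1
  · have hset : (Finset.univ : Finset (TorusSite D Lc)).filter
        (fun t => nest N' N m t ∉ (newLabels N N' : Finset (TorusSite D N'))) = {unnestM N Lc (lift N' m)} := by
      ext t
      simp only [Finset.mem_filter, Finset.mem_univ, true_and, Finset.mem_singleton, nest_not_mem_newLabels_iff hN]
    rw [hset, Finset.sum_singleton, nest_unnestM_lift hN]
  · refine Finset.sum_congr ?_ fun _ _ => rfl
    ext t
    simp only [Finset.mem_filter, Finset.mem_univ, true_and, not_not]

/-- [folklore] **RE-INDEXING THE UNMATCHED SUB-ALIASES BY THE NEW LABELS**: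
`Σ_m Σ_{t : nest m t ∈ newLabels} G (nest m t) = Σ_{m′ ∈ newLabels N N′} G m′` (the nesting is a bijection, `AliasNest.sum_nest`). -/
theorem sum_sum_nest_mem_newLabels {E : Type*} [AddCommMonoid E] (hN : N' = N * Lc) (G : TorusSite D N' → E) :
    ∑ m : TorusSite D N, ∑ t ∈ (Finset.univ : Finset (TorusSite D Lc)).filter
        (fun t => nest N' N m t ∈ (newLabels N N' : Finset (TorusSite D N'))), G (nest N' N m t) =
      ∑ m' ∈ (newLabels N N' : Finset (TorusSite D N')), G m' := by
  classical
  have h := sum_nest (D := D) hN (fun m' => if m' ∈ (newLabels N N' : Finset (TorusSite D N')) then G m' else 0)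
  rw [Finset.sum_ite_mem, Finset.univ_inter] at h
  rw [h]
  refine Finset.sum_congr rfl fun m _ => ?_
  rw [Finset.sum_filter]

end Dictionary

/-! ## §2 The box weight on the strip -/

section BoxW

variable {d N' : ℕ} [NeZero N'] {p : Fin (d + 1) → ℂ} {η : ℝ}

/-- [folklore] **THE BOX WEIGHT OF A FINE MOMENTUM ON THE STRIP**: `‖boxW Lc (k′_{m′})‖ ≤ Lc^{d+1}·e^{(d+1)η}` for `|Im p_i| ≤ η`, `Lc ≤ N′`
(each cell plane wave has modulus `≤ e^{(d+1)η}`: fine momentum `Im k′ = Im p / N′`, cell coordinates `< Lc ≤ N′`). -/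
theorem norm_boxW_kFine_le (him : ∀ i, |(p i).im| ≤ η) {Lc : ℕ} (hLc : Lc ≤ N') (m' : TorusSite (d + 1) N') :
    ‖boxW Lc (kFine p m')‖ ≤ (Lc : ℝ) ^ (d + 1) * Real.exp ((d + 1) * η) := by
  have hN : (0 : ℝ) < N' := by exact_mod_cast Nat.pos_of_ne_zero (NeZero.ne N')
  unfold boxW
  have hterm : ∀ r ∈ box (d + 1) Lc, ‖pw (kFine p m') (toSite r)‖ ≤ Real.exp ((d + 1) * η) := by
    intro r hr
    have e : pw (kFine p m') (toSite r) = cexp (I * ∑ i, kAl N' p m' i * (((1 : ℕ) : ℂ) * (toSite r i : ℂ))) := by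
      unfold pw kAl; simp only [Nat.cast_one, one_mul]
    rw [e, norm_cexp_offset_eq]
    apply Real.exp_le_exp.2
    simp only [Nat.cast_one, one_mul]
    have hri : ∀ i, |((toSite r i : ℤ) : ℝ)| ≤ N' := by
      intro i
      have h := (Fintype.mem_piFinset.mp hr) i
      rw [Finset.mem_range] at h
      simp only [toSite, Int.cast_natCast, Nat.abs_cast]
      exact_mod_cast (h.le.trans hLc)
    calc -∑ i, (p i).im / N' * ((toSite r i : ℤ) : ℝ) = ∑ i, (-((p i).im / N' * ((toSite r i : ℤ) : ℝ))) := by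
          rw [Finset.sum_neg_distrib]
      _ ≤ ∑ _i : Fin (d + 1), η := Finset.sum_le_sum fun i _ => by
          have h1 : |(p i).im / N' * ((toSite r i : ℤ) : ℝ)| ≤ η / N' * N' := by
            rw [abs_mul, abs_div, abs_of_pos hN]
            exact mul_le_mul (div_le_div_of_nonneg_right (him i) hN.le) (hri i) (abs_nonneg _)
              (div_nonneg ((abs_nonneg _).trans (him i)) hN.le)
          rw [div_mul_cancel₀ _ hN.ne'] at h1
          linarith [neg_abs_le ((p i).im / N' * ((toSite r i : ℤ) : ℝ)), abs_nonneg ((p i).im / N' * ((toSite r i : ℤ) : ℝ))]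
      _ = (d + 1) * η := by rw [Finset.sum_const, Finset.card_univ, Fintype.card_fin, nsmul_eq_mul]; push_cast; ring
  have hcard : (box (d + 1) Lc).card = Lc ^ (d + 1) := by
    simp [AffineAveraging.box, Fintype.card_piFinset, Finset.card_range, Finset.prod_const, Finset.card_univ, Fintype.card_fin]
  calc ‖∑ r ∈ box (d + 1) Lc, pw (kFine p m') (toSite r)‖ ≤ ∑ r ∈ box (d + 1) Lc, ‖pw (kFine p m') (toSite r)‖ := norm_sum_le _ _
    _ ≤ ∑ _r ∈ box (d + 1) Lc, Real.exp ((d + 1) * η) := Finset.sum_le_sum hterm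
    _ = (Lc : ℝ) ^ (d + 1) * Real.exp ((d + 1) * η) := by rw [Finset.sum_const, hcard, nsmul_eq_mul]; push_cast; ring

end BoxW

/-! ## §3 PART K in the fold's coordinates: the unmatched sub-aliases, box-weighted, are `O(1/N)` -/

section Tail

variable {d N N' Lc : ℕ} [NeZero N] [NeZero N'] [NeZero Lc] {p : Fin (d + 1) → ℂ} {η : ℝ}

/-- [folklore] **THE UNMATCHED SUB-ALIAS TAIL OF THE FOLDED CELL SUM** (E3A currency; (U1)+A at the finer side `N′ = N·Lc`): summed over the
level-`N` aliases `m`, the box-weighted amplitudes of the sub-aliases `nest m t` that are NEW LABELS, with the fold's prefactor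
`(Lc^{d+1})⁻¹·N′^{d+2}` and the level-`N` plane wave, total at most `e^{2(d+1)η}·A·K_{d+1}·(2/N)·(r₀²C₀ + r₀³C₁)` — uniformly in `N′`, `p`, `κ`,
`l`, `ζ` (`‖boxW‖ ≤ Lc^{d+1}e^{(d+1)η}` × `FineReadoutCauchyTail.sum_newLabels_norm_le`, re-indexed by `sum_sum_nest_mem_newLabels`). -/
theorem sum_norm_foldTail_le (hN : N' = N * Lc) (hre : ∀ i, |(p i).re| ≤ π) (him : ∀ i, |(p i).im| ≤ η) (hη : 0 ≤ η)
    (hη4 : η ≤ 1 / 4) (hηD : (3 * (d + 1 : ℕ) / 2 + 2) * η ≤ 1 / 2)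
    (hdet : (trigPolySymbol (stencil (d + 1)) (pieceMatrix (N := N')) p).det ≠ 0)
    {r : TorusSite (d + 1) N' → ℝ} (hr : ∀ m, 0 < r m) {r0 : ℝ} (hr0 : 0 < r0) {A : ℝ} (hA0 : 0 ≤ A)
    (hU : IsUnit (arrowMat (scaledArrow N' r r0 p))) (hA : ‖(arrowMat (scaledArrow N' r r0 p))⁻¹‖ ≤ A)
    (l κ : Fin (d + 1)) (ζ : TorusSite (d + 1) N) :
    ∑ m : TorusSite (d + 1) N,
        ‖(((Lc : ℂ) ^ (d + 1))⁻¹ * ((N' : ℂ) ^ (d + 2)) *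
            ∑ t ∈ (Finset.univ : Finset (TorusSite (d + 1) Lc)).filter
              (fun t => nest N' N m t ∈ (newLabels N N' : Finset (TorusSite (d + 1) N'))),
              boxW Lc (kFine p (nest N' N m t)) * ampA p (fun i => fibInv N' i (Sum.inr (Sum.inr l)) p) (nest N' N m t) κ) *
          pw (kFine p m) (repZ ζ)‖
      ≤ Real.exp ((d + 1) * η) * Real.exp ((d + 1) * η) * A *
          (Real.sqrt 12 ^ (d + 1) * (Real.sqrt 6 * (1 + 8 * (d + 1 : ℕ)))) * (2 / N) *
          (r0 ^ 2 * ((3 * π) ^ (1 - (0 : ℝ)) * (3 : ℝ) ^ (d + 1) * aliasConst (d + 1) 0)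
            + r0 ^ 3 * ((3 * π) ^ (1 - (-1 : ℝ)) * (3 : ℝ) ^ (d + 1) * aliasConst (d + 1) (-1))) := by
  classical
  set v' : Idx (d + 1) N' → ℂ := fun i => fibInv N' i (Sum.inr (Sum.inr l)) p with hv'
  set E : ℝ := Real.exp ((d + 1) * η) with hE
  set K : ℝ := Real.sqrt 12 ^ (d + 1) * (Real.sqrt 6 * (1 + 8 * (d + 1 : ℕ))) with hK
  set W : ℝ := r0 ^ 2 * ((3 * π) ^ (1 - (0 : ℝ)) * (3 : ℝ) ^ (d + 1) * aliasConst (d + 1) 0)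
      + r0 ^ 3 * ((3 * π) ^ (1 - (-1 : ℝ)) * (3 : ℝ) ^ (d + 1) * aliasConst (d + 1) (-1)) with hW
  have hN'pos : (0 : ℝ) < N' := by exact_mod_cast Nat.pos_of_ne_zero (NeZero.ne N')
  have hLc : (0 : ℝ) < Lc := by exact_mod_cast Nat.pos_of_ne_zero (NeZero.ne Lc)
  have hLcN' : Lc ≤ N' := by rw [hN]; exact Nat.le_mul_of_pos_left _ (Nat.pos_of_ne_zero (NeZero.ne N))
  have hE0 : 0 ≤ E := (Real.exp_pos _).le
  have hK0 : 0 ≤ K := by positivity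
  -- the King tail of the amplitudes over the new labels
  have hKsum : ∑ m' ∈ (newLabels N N' : Finset (TorusSite (d + 1) N')), ‖ampA p v' m' κ‖ ≤ A * ((N' : ℝ) ^ (d + 1 + 1))⁻¹ * K * (2 / N) * W := by
    have h := sum_newLabels_norm_le (D := d + 1) (N := N) (N' := N') (Nat.succ_pos d) (fun m' => ampA p v' m' κ)
      (B := A * ((N' : ℝ) ^ (d + 1 + 1))⁻¹ * K) (a := r0 ^ 2) (b := r0 ^ 3) (by positivity) (by positivity) (by positivity)
      (fun m' hm' => norm_ampA_le_pointWeight hre him hη hη4 hηD hdet hr hr0 hA0 hU hA l κ hm')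
    simpa only [hW] using h
  -- the prefactor and the box weight
  have hpre : ‖((Lc : ℂ) ^ (d + 1))⁻¹ * ((N' : ℂ) ^ (d + 2))‖ = ((Lc : ℝ) ^ (d + 1))⁻¹ * (N' : ℝ) ^ (d + 2) := by
    rw [norm_mul, norm_inv, norm_pow, norm_pow, Complex.norm_natCast, Complex.norm_natCast]
  have hterm : ∀ m : TorusSite (d + 1) N,
      ‖(((Lc : ℂ) ^ (d + 1))⁻¹ * ((N' : ℂ) ^ (d + 2)) *
            ∑ t ∈ (Finset.univ : Finset (TorusSite (d + 1) Lc)).filter (fun t => nest N' N m t ∈ (newLabels N N' : Finset (TorusSite (d + 1) N'))),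
              boxW Lc (kFine p (nest N' N m t)) * ampA p v' (nest N' N m t) κ) * pw (kFine p m) (repZ ζ)‖
        ≤ (((Lc : ℝ) ^ (d + 1))⁻¹ * (N' : ℝ) ^ (d + 2)) * (((Lc : ℝ) ^ (d + 1) * E) *
            ∑ t ∈ (Finset.univ : Finset (TorusSite (d + 1) Lc)).filter (fun t => nest N' N m t ∈ (newLabels N N' : Finset (TorusSite (d + 1) N'))),
              ‖ampA p v' (nest N' N m t) κ‖) * E := by
    intro m
    rw [norm_mul, norm_mul, hpre]
    refine mul_le_mul (mul_le_mul_of_nonneg_left ?_ (by positivity)) (norm_pw_repZ_le him m ζ) (norm_nonneg _) (by positivity)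
    rw [Finset.mul_sum]
    refine (norm_sum_le _ _).trans (Finset.sum_le_sum fun t _ => ?_)
    rw [norm_mul]
    exact mul_le_mul_of_nonneg_right (norm_boxW_kFine_le him hLcN' _) (norm_nonneg _)
  have hsum := Finset.sum_le_sum fun m (_ : m ∈ (Finset.univ : Finset (TorusSite (d + 1) N))) => hterm m
  refine hsum.trans ?_
  rw [← Finset.sum_mul, ← Finset.mul_sum, ← Finset.mul_sum,
    sum_sum_nest_mem_newLabels (D := d + 1) hN (fun m' => ‖ampA p v' m' κ‖)]
  have hc : ((Lc : ℝ) ^ (d + 1))⁻¹ * (N' : ℝ) ^ (d + 2) *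
      ((Lc : ℝ) ^ (d + 1) * E * ∑ m' ∈ (newLabels N N' : Finset (TorusSite (d + 1) N')), ‖ampA p v' m' κ‖) * E
      = (N' : ℝ) ^ (d + 2) * E * E * ∑ m' ∈ (newLabels N N' : Finset (TorusSite (d + 1) N')), ‖ampA p v' m' κ‖ := by
    field_simp
  rw [hc]
  calc (N' : ℝ) ^ (d + 2) * E * E * ∑ m' ∈ (newLabels N N' : Finset (TorusSite (d + 1) N')), ‖ampA p v' m' κ‖
      ≤ (N' : ℝ) ^ (d + 2) * E * E * (A * ((N' : ℝ) ^ (d + 1 + 1))⁻¹ * K * (2 / N) * W) :=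
        mul_le_mul_of_nonneg_left hKsum (by positivity)
    _ = E * E * A * K * (2 / N) * W := by field_simp

end Tail

/-! ## §4 THE DIFFERENCE SYMBOL = MATCHED TERMS + AN `O(1/N)` TAIL -/

section Split

variable {d N N' Lc : ℕ} [NeZero N] [NeZero N'] [NeZero Lc] {p : Fin (d + 1) → ℂ} {η : ℝ}

/-- [folklore] **THE DIFFERENCE SYMBOL SPLITS INTO THE MATCHED COMPARISON AND THE NEW-LABEL TAIL** (E3A amplitudes `ampA` at both levels,
expansions by `FibreDFTDictionary.boxData_inl_eq_sum` — no hypothesis; `N′ = N·Lc`):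
`diffSym = Σ_m [(Lc^{d+1})⁻¹N′^{d+2}·boxW(k′_{lift m})·Â′_{lift m,κ} − N^{d+2}·Â_{mκ}]·e^{ik_m·ζ} + Σ_m [(Lc^{d+1})⁻¹N′^{d+2}·Σ_{t: nest m t new} boxW(k′)·Â′_{nest m t,κ}]·e^{ik_m·ζ}`. -/
theorem diffSym_eq_matched_add_tail (hN : N' = N * Lc) (p : Fin (d + 1) → ℂ) (κ l : Fin (d + 1)) (z : Site (d + 1)) :
    diffSym N N' Lc κ l z p =
      (∑ m : TorusSite (d + 1) N,
        (((Lc : ℂ) ^ (d + 1))⁻¹ * ((N' : ℂ) ^ (d + 2)) *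
            (boxW Lc (kFine p (lift N' m)) * ampA p (fun i => fibInv N' i (Sum.inr (Sum.inr l)) p) (lift N' m) κ) -
          ((N : ℂ) ^ (d + 2)) * ampA p (fun i => fibInv N i (Sum.inr (Sum.inr l)) p) m κ) * pw (kFine p m) (repZ (Torus.proj N z))) +
      ∑ m : TorusSite (d + 1) N,
        (((Lc : ℂ) ^ (d + 1))⁻¹ * ((N' : ℂ) ^ (d + 2)) *
            ∑ t ∈ (Finset.univ : Finset (TorusSite (d + 1) Lc)).filter
              (fun t => nest N' N m t ∈ (newLabels N N' : Finset (TorusSite (d + 1) N'))),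
              boxW Lc (kFine p (nest N' N m t)) * ampA p (fun i => fibInv N' i (Sum.inr (Sum.inr l)) p) (nest N' N m t) κ) *
          pw (kFine p m) (repZ (Torus.proj N z)) := by
  classical
  set v : Idx (d + 1) N → ℂ := fun i => fibInv N i (Sum.inr (Sum.inr l)) p with hv
  set v' : Idx (d + 1) N' → ℂ := fun i => fibInv N' i (Sum.inr (Sum.inr l)) p with hv'
  rw [diffSym_eq_sum_fold hN p κ l z (ampA p v) (ampA p v') (fun ζ => boxData_inl_eq_sum p v κ ζ)
    (fun ζ => boxData_inl_eq_sum p v' κ ζ), ← Finset.sum_add_distrib]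
  refine Finset.sum_congr rfl fun m _ => ?_
  rw [sum_nest_eq_lift_add hN m (fun m' => boxW Lc (kFine p m') * ampA p v' m' κ)]
  ring

/-- [folklore] **«(N1-Cauchy)»'s STRIP BOUND REDUCES TO THE MATCHED COMPARISON** (E3A currency; (U1)+A at the finer side `N′ = N·Lc`):
`‖diffSym N N′ Lc κ l z p‖ ≤ e^{(d+1)η}·Σ_m ‖(Lc^{d+1})⁻¹N′^{d+2}·boxW(k′_{lift m})·Â′_{lift m,κ} − N^{d+2}·Â_{mκ}‖ + e^{2(d+1)η}·A·K·(2/N)·(r₀²C₀ + r₀³C₁)`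
— the first sum is division PART A's object (matched sub-alias `lift N′ m`, same symmetric representative), the second term is PART K. -/
theorem norm_diffSym_le_matched_add (hN : N' = N * Lc) (hre : ∀ i, |(p i).re| ≤ π) (him : ∀ i, |(p i).im| ≤ η) (hη : 0 ≤ η)
    (hη4 : η ≤ 1 / 4) (hηD : (3 * (d + 1 : ℕ) / 2 + 2) * η ≤ 1 / 2)
    (hdet : (trigPolySymbol (stencil (d + 1)) (pieceMatrix (N := N')) p).det ≠ 0)
    {r : TorusSite (d + 1) N' → ℝ} (hr : ∀ m, 0 < r m) {r0 : ℝ} (hr0 : 0 < r0) {A : ℝ} (hA0 : 0 ≤ A)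
    (hU : IsUnit (arrowMat (scaledArrow N' r r0 p))) (hA : ‖(arrowMat (scaledArrow N' r r0 p))⁻¹‖ ≤ A)
    (κ l : Fin (d + 1)) (z : Site (d + 1)) :
    ‖diffSym N N' Lc κ l z p‖
      ≤ Real.exp ((d + 1) * η) * ∑ m : TorusSite (d + 1) N,
            ‖((Lc : ℂ) ^ (d + 1))⁻¹ * ((N' : ℂ) ^ (d + 2)) *
                (boxW Lc (kFine p (lift N' m)) * ampA p (fun i => fibInv N' i (Sum.inr (Sum.inr l)) p) (lift N' m) κ) -
              ((N : ℂ) ^ (d + 2)) * ampA p (fun i => fibInv N i (Sum.inr (Sum.inr l)) p) m κ‖ +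
        Real.exp ((d + 1) * η) * Real.exp ((d + 1) * η) * A *
          (Real.sqrt 12 ^ (d + 1) * (Real.sqrt 6 * (1 + 8 * (d + 1 : ℕ)))) * (2 / N) *
          (r0 ^ 2 * ((3 * π) ^ (1 - (0 : ℝ)) * (3 : ℝ) ^ (d + 1) * aliasConst (d + 1) 0)
            + r0 ^ 3 * ((3 * π) ^ (1 - (-1 : ℝ)) * (3 : ℝ) ^ (d + 1) * aliasConst (d + 1) (-1))) := by
  rw [diffSym_eq_matched_add_tail hN p κ l z]
  refine (norm_add_le _ _).trans (add_le_add ?_ ?_)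
  · refine (norm_sum_le _ _).trans ?_
    rw [Finset.mul_sum]
    refine Finset.sum_le_sum fun m _ => ?_
    rw [norm_mul, mul_comm]
    exact mul_le_mul_of_nonneg_right (norm_pw_repZ_le him m _) (norm_nonneg _)
  · exact (norm_sum_le _ _).trans (sum_norm_foldTail_le hN hre him hη hη4 hηD hdet hr hr0 hA0 hU hA l κ _)

end Split

/-! ## §5 `d = 3`: the reduction with the tail UNCONDITIONAL, one strip for all levels -/

section Four

variable {Lc : ℕ} [NeZero Lc]

/-- [folklore] **«(N1-Cauchy)» AT `d = 3` REDUCES TO PART A** (road P1's (U1)+A BY NAME, `FibreDetStripHolds.exists_strip`): ONE half-width `κ₁ > 0`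
and ONE constant `C ≥ 0` such that for every member `n` (levels `N = Lc^(n+1) ⊂ N′ = Lc^(n+2)`), every `p ∈ Strip 4 κ₁`, every `κ l z`,
`‖diffSym N N′ Lc κ l z p‖ ≤ e^{4κ₁}·Σ_m ‖(Lc^4)⁻¹N′^5·boxW(k′_{lift m})·Â′_{lift m,κ}(p) − N^5·Â_{mκ}(p)‖ + C·(Lc⁻¹)^(n+1)` —
so a matched-alias bound `Σ_m ‖…‖ ≤ c_A·θ^n` on the punctured strip (division PART A, with PART C inside) IS the punctured-strip bound of
the holder's `FineReadoutCauchyOfPieces.exists_wH_cellMean_cauchy_of_punctured`, with `θ′ = max θ Lc⁻¹`. -/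
theorem exists_norm_diffSym_le_matched_add :
    ∃ κ₁ C : ℝ, 0 < κ₁ ∧ 0 ≤ C ∧ ∀ (n : ℕ) (p : Fin (3 + 1) → ℂ), p ∈ Strip (3 + 1) κ₁ →
      ∀ (κ l : Fin (3 + 1)) (z : Site (3 + 1)),
        ‖diffSym (Lc ^ (n + 1)) (Lc ^ (n + 2)) Lc κ l z p‖
          ≤ Real.exp ((3 + 1) * κ₁) * ∑ m : TorusSite (3 + 1) (Lc ^ (n + 1)),
                ‖((Lc : ℂ) ^ (3 + 1))⁻¹ * (((Lc ^ (n + 2) : ℕ) : ℂ) ^ (3 + 2)) *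
                    (boxW Lc (kFine p (lift (Lc ^ (n + 2)) m)) *
                      ampA p (fun i => fibInv (Lc ^ (n + 2)) i (Sum.inr (Sum.inr l)) p) (lift (Lc ^ (n + 2)) m) κ) -
                  (((Lc ^ (n + 1) : ℕ) : ℂ) ^ (3 + 2)) * ampA p (fun i => fibInv (Lc ^ (n + 1)) i (Sum.inr (Sum.inr l)) p) m κ‖ +
            C * ((Lc : ℝ)⁻¹) ^ (n + 1) := by
  obtain ⟨ρ₀, κ₀, A, hρ₀, hκ₀, _hκρ, hκ4, hA, hdet, hpair⟩ := exists_strip (d := 3) (Lc := Lc)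
  set κ₁ : ℝ := min κ₀ (1 / 16) with hκ₁
  have hκ₁0 : 0 < κ₁ := lt_min hκ₀ (by norm_num)
  have hκ₁le : κ₁ ≤ κ₀ := min_le_left _ _
  have hκ₁4 : κ₁ ≤ 1 / 4 := (min_le_right _ _).trans (by norm_num)
  have hκ₁D : (3 * (3 + 1 : ℕ) / 2 + 2) * κ₁ ≤ 1 / 2 := by
    have := min_le_right κ₀ (1 / 16 : ℝ); push_cast; nlinarith
  set R0 : ℝ := 2 * π with hR0
  have hR0pos : 0 < R0 := by rw [hR0]; positivity
  set K : ℝ := Real.sqrt 12 ^ (3 + 1) * (Real.sqrt 6 * (1 + 8 * (3 + 1 : ℕ))) with hK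
  set C0 : ℝ := (3 * π) ^ (1 - (0 : ℝ)) * (3 : ℝ) ^ (3 + 1) * aliasConst (3 + 1) 0 with hC0
  set C1 : ℝ := (3 * π) ^ (1 - (-1 : ℝ)) * (3 : ℝ) ^ (3 + 1) * aliasConst (3 + 1) (-1) with hC1
  have hC0' : 0 ≤ C0 := mul_nonneg (by positivity) (FineReadoutDecay.aliasConst_nonneg (Nat.succ_pos 3) (by norm_num))
  have hC1' : 0 ≤ C1 := mul_nonneg (by positivity) (FineReadoutDecay.aliasConst_nonneg (Nat.succ_pos 3) (by norm_num))
  refine ⟨κ₁, Real.exp ((3 + 1) * κ₁) * Real.exp ((3 + 1) * κ₁) * A * K * 2 * (R0 ^ 2 * C0 + R0 ^ 3 * C1), hκ₁0, by positivity,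
    fun n p hp κ l z => ?_⟩
  haveI : NeZero (Lc ^ (n + 2)) := ⟨pow_ne_zero _ (NeZero.ne Lc)⟩
  haveI : NeZero (Lc ^ (n + 1)) := ⟨pow_ne_zero _ (NeZero.ne Lc)⟩
  have hp0 : p ∈ Strip (3 + 1) κ₀ := fun μ => ⟨(hp μ).1, (hp μ).2.trans hκ₁le⟩
  have hdet₁ := hdet (n + 1) p hp0
  obtain ⟨r, r0, hr, hr0, hr0R, hU, hAi⟩ : ∃ (r : TorusSite (3 + 1) (Lc ^ (n + 1 + 1)) → ℝ) (r0 : ℝ), (∀ m, 0 < r m) ∧ 0 < r0 ∧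
      r0 ≤ R0 ∧ IsUnit (arrowMat (scaledArrow (Lc ^ (n + 1 + 1)) r r0 p)) ∧ ‖(arrowMat (scaledArrow (Lc ^ (n + 1 + 1)) r r0 p))⁻¹‖ ≤ A := by
    have hq : ∀ i, |reVec p i| ≤ π := fun i => (hp0 i).1
    rcases hpair (n + 1) p hp0 with ⟨_, hU, hAi⟩ | ⟨_, _, hq0, hU, hAi⟩
    · refine ⟨radI (Lc ^ (n + 1 + 1)), 1, radI_pos, one_pos, ?_, hU, hAi⟩
      rw [hR0]; have := Real.pi_gt_three; linarith
    · exact ⟨radO (Lc ^ (n + 1 + 1)) (reVec p), radO (Lc ^ (n + 1 + 1)) (reVec p) 0, radO_pos hq hq0, radO_pos hq hq0 0,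
        radO_zero_le_two_pi hq, hU, hAi⟩
  have h := norm_diffSym_le_matched_add (N := Lc ^ (n + 1)) (N' := Lc ^ (n + 2)) (Lc := Lc) (pow_succ Lc (n + 1))
    (fun i => (hp i).1) (fun i => (hp i).2) hκ₁0.le hκ₁4 hκ₁D hdet₁ hr hr0 hA hU hAi κ l z
  refine h.trans (add_le_add (le_of_eq ?_) ?_)
  · push_cast; ring_nf
  have hLc : (0 : ℝ) < Lc := by exact_mod_cast Nat.pos_of_ne_zero (NeZero.ne Lc)
  have hW : R0 ^ 2 * C0 + R0 ^ 3 * C1 ≥ r0 ^ 2 * C0 + r0 ^ 3 * C1 := by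
    have h2 : r0 ^ 2 ≤ R0 ^ 2 := pow_le_pow_left₀ hr0.le hr0R 2
    have h3 : r0 ^ 3 ≤ R0 ^ 3 := pow_le_pow_left₀ hr0.le hr0R 3
    nlinarith [mul_le_mul_of_nonneg_right h2 hC0', mul_le_mul_of_nonneg_right h3 hC1']
  have hE : 0 ≤ Real.exp ((3 + 1) * κ₁) * Real.exp ((3 + 1) * κ₁) * A * K * (2 / ((Lc ^ (n + 1) : ℕ) : ℝ)) := by positivity
  calc Real.exp ((3 + 1) * κ₁) * Real.exp ((3 + 1) * κ₁) * A * K * (2 / ((Lc ^ (n + 1) : ℕ) : ℝ)) * (r0 ^ 2 * C0 + r0 ^ 3 * C1)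
      ≤ Real.exp ((3 + 1) * κ₁) * Real.exp ((3 + 1) * κ₁) * A * K * (2 / ((Lc ^ (n + 1) : ℕ) : ℝ)) * (R0 ^ 2 * C0 + R0 ^ 3 * C1) :=
        mul_le_mul_of_nonneg_left hW hE
    _ = Real.exp ((3 + 1) * κ₁) * Real.exp ((3 + 1) * κ₁) * A * K * 2 * (R0 ^ 2 * C0 + R0 ^ 3 * C1) * ((Lc : ℝ)⁻¹) ^ (n + 1) := by
        push_cast
        rw [inv_pow]
        ring

end Four

end Summit.QuantumFields.BalabanUV.Beta.GAN24.FineReadoutCauchyTailFold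

end
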